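import Literature.AlgebraicGeometry.HodgeTheory.HodgeTypeOfFlatSectionsProjectiveTotal
import Literature.AlgebraicGeometry.HodgeTheory.AlgebraicityLocusIUnionClosedProofs
import Literature.AlgebraicGeometry.HodgeTheory.DivisorClassesFiniteEtaleBaseChange
import Literature.AlgebraicGeometry.HodgeTheory.ClassesSupportedOn
import HarnessLib

/-!
# Crux `NodalThetaSupport` (stmt-HodgeConjecture-7744), line `support-transport` — stubs S1/S2 over SMOOTH bases

Route `NodalThetaWeil`, crux X1 `Theses.NodalThetaWeil.NodalThetaSupport`; ALT line `support-transport`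
(`Cruxes/NodalThetaSupport/Lines/support_transport.lean`), registered stubs

* S1 `stub_supportLocus_specialisation` — the support locus `Σ(σ, 𝒟) = {s | σ(s) dies on (𝒳_s ∖ 𝒟_s)(ℂ)}`
  of a flat class `σ` and a Zariski-closed `𝒟 ⊆ 𝒳` is closed under specialisation: if it contains the
  complex points of a non-empty Zariski-open `U` it is all of `S(ℂ)`;
* S2 `stub_supportLocus_genericTransport` — over some non-empty Zariski-open `U ⊆ S`, membership in
  `Σ(σ, 𝒟)` is all-or-nothing;

both typed for a smooth projective family `f : 𝒳 ⟶ S` over an IRREDUCIBLE quasi-projective base with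
quasi-projective total space. This file proves both with ONE extra hypothesis, `Smooth S.hom` — which the
line's composition has anyway (its stub S3 supplies "a smooth projective family over a smooth irreducible
quasi-projective base"), so the lead may reshape S1/S2 by adding it and close them by the theorems below.
(`IsSupportedOnSlice 𝒟 x`, a definition of the line file, is spelled out:
`x.cls ∈ classesSupportedOn (fiberOver f x.pt) ((fiberι f x.pt)⁻¹ 𝒟) k`.)

Mechanism, entirely from tree THEOREMS (no named fact): over a smooth irreducible quasi-projective base a
continuous section `σ` of the espace étalé `FiberClass f k` is the global section of ONE class
`A ∈ Hᵏ(𝒳(ℂ); ℂ)` (`exists_forall_eq_globalSection_of_isQuasiProjectiveOver`: Deligne 1968 — the tree's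
PROVED `deligne1968_invariantClass_fromTotalSpace_holds` — plus the identity principle); for a global class
the support locus is the "good set" of the algebraicity-locus programme for the constant family of supports
`𝒵 = pr₁⁻¹ 𝒟 ⊆ 𝒳 × S`: it is strongly closed and stable under Zariski closure of locally constructible
sets of parameters (`map_fiberι_mem_ker_restrictCompl_of_pt_mem_closure`, upper semicontinuity of supports
+ SGA1 XII 2.2) — S1 —, and over the generic part of the irreducible `S` it is all-or-nothing by Verdier-type
generic local triviality of the COMPLEMENT family (`complTrivialisation_generic`, log resolution + relative
Ehresmann, and `dichotomy_of_complTrivialisation`) — S2.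

* `supportLocus_eq_preimage` — the slice of `𝒵 = pr₁⁻¹ 𝒟` over `s` is `𝒟_s = ι_s⁻¹ 𝒟`;
* `supportLocus_specialisation_of_smooth` — S1 with `Smooth S.hom`;
* `supportLocus_genericTransport_of_smooth` — S2 with `Smooth S.hom`.

Why the registered forms are not proved here: without smoothness of `S` (e.g. `S` generically
non-reduced) the tree has no local triviality of `Rᵏ f_* ℂ` on `S(ℂ)` (Ehresmann is stated over smooth
bases: `isCohomologicallyLocallyTrivialOn_univ_of_isSmoothProjectiveFamily[_of_smooth]`), hence no tube
representation of continuous sections and no passage to a global or tube class.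

References: [CharlesSchnell2014Notes] F. Charles, C. Schnell, Notes on absolute Hodge classes (2014), proof of
Prop. 11.3.11; [VoisinHodgeII2003] C. Voisin, Hodge Theory and Complex Algebraic Geometry II (2003), §3.3.1,
Thm. 4.18, Lemma 4.17; [SGA1] Exp. XII Prop. 2.2, 2.4; [Verdier1976] J.-L. Verdier, Invent. Math. 36 (1976),
Cor. (5.1).
-/

-- `Summit.<Summit>.<Problem>`: for the single-conjunct summit `HodgeConjecture` the duplicate component is mandated.
set_option linter.dupNamespace false

noncomputable section

open CategoryTheory AlgebraicGeometry Topology MonoidalCategory CartesianMonoidalCategory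
open Literature.AlgebraicGeometry Literature.AlgebraicGeometry.Motives Literature.AlgebraicGeometry.HodgeTheory

namespace Summit.HodgeConjecture.HodgeConjecture.Theorems

section SupportLocus

variable {𝒳 S : SchemeOver ℂ} (f : 𝒳 ⟶ S)

/-- The slice over `s ∈ S(ℂ)` of the constant family of supports `𝒵 = pr₁⁻¹ 𝒟 ⊆ 𝒳 × S` — its preimage
under `(ι_s, s) : 𝒳_s ⟶ 𝒳 × S` — is `𝒟_s = ι_s⁻¹ 𝒟`. [folklore] -/
theorem supportLocus_eq_preimage (𝒟 : Set 𝒳.left) (s : ComplexPoints S) :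
    (CartesianMonoidalCategory.lift (fiberι f (AlgPoints.map (𝟙 S) s))
        (fiberOverToSpec f (AlgPoints.map (𝟙 S) s) ≫ s)).left.base ⁻¹'
        ((fst 𝒳 S).left.base ⁻¹' 𝒟) =
      (fiberι f (AlgPoints.map (𝟙 S) s)).left.base ⁻¹' 𝒟 := by
  ext x
  simp only [Set.mem_preimage]
  rw [← Scheme.Hom.comp_apply, ← Over.comp_left, CartesianMonoidalCategory.lift_fst]

variable {f}

/-- **The support locus of a GLOBAL class is stable under Zariski closure** (smooth projective family over a
smooth quasi-projective base; `𝒟 ⊆ 𝒳` closed): if `A|_{𝒳_s}` dies off `𝒟_s` for all complex points `s`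
over a locally constructible `T ⊆ S`, it does so over `T̄` — the good set of the constant family of
supports `pr₁⁻¹ 𝒟 ⊆ 𝒳 × S` is strongly closed (upper semicontinuity of supports) and `T̄(ℂ)` is the strong
closure of `T(ℂ)` (SGA1 XII 2.2): the tree's `map_fiberι_mem_ker_restrictCompl_of_pt_mem_closure` with
parameter map `𝟙 S`. [cite: CharlesSchnell2014Notes, Prop. 11.3.11 (proof)] [cite: SGA1, Exp. XII Prop. 2.2] -/
theorem map_fiberι_mem_classesSupportedOn_of_pt_mem_closure {n : ℕ} (hf : IsSmoothProjectiveFamily f n)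
    (hS : IsQuasiProjectiveOver S) (hSsm : AlgebraicGeometry.Smooth S.hom) {𝒟 : Set 𝒳.left}
    (h𝒟 : IsClosed 𝒟) (k : ℕ) (A : complexBetti 𝒳 k) {T : Set S.left} (hT : IsLocallyConstructible T)
    (hgood : ∀ s : ComplexPoints S, s.pt ∈ T →
      complexBetti.map (fiberι f s) k A ∈ classesSupportedOn (fiberOver f s) ((fiberι f s).left.base ⁻¹' 𝒟) k)
    (s : ComplexPoints S) (hs : s.pt ∈ closure T) :
    complexBetti.map (fiberι f s) k A ∈ classesSupportedOn (fiberOver f s) ((fiberι f s).left.base ⁻¹' 𝒟) k := by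
  have h𝒵 : IsClosed ((fst 𝒳 S).left.base ⁻¹' 𝒟) := h𝒟.preimage (fst 𝒳 S).left.base.hom.continuous
  have h := map_fiberι_mem_ker_restrictCompl_of_pt_mem_closure f hf hS hSsm (𝟙 S) h𝒵 k A hT
    (fun y hy => by
      rw [supportLocus_eq_preimage f 𝒟 y, AlgPoints.map_id_apply]
      exact hgood y hy) s hs
  rw [supportLocus_eq_preimage f 𝒟 s, AlgPoints.map_id_apply] at h
  exact h

/-- **Generic dichotomy for the support locus of a GLOBAL class** (smooth projective family over an
irreducible quasi-projective base, `𝒟 ⊆ 𝒳` closed): there is a non-empty open `O ⊆ S` over whose complex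
points `A|_{𝒳_s}` dies off `𝒟_s` either always or never — Verdier-type generic local triviality of the
complement of `pr₁⁻¹ 𝒟` over the generic part of `S` (`complTrivialisation_generic`) and the dichotomy
`dichotomy_of_complTrivialisation`. No smoothness of `S` is needed here.
[cite: CharlesSchnell2014Notes, Prop. 11.3.11 (proof)] [cite: Verdier1976, Cor. (5.1)] -/
theorem exists_opens_supportLocus_dichotomy {n : ℕ} (hf : IsSmoothProjectiveFamily f n)
    [IrreducibleSpace S.left] (hS : IsQuasiProjectiveOver S) {𝒟 : Set 𝒳.left} (h𝒟 : IsClosed 𝒟)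
    (k : ℕ) (A : complexBetti 𝒳 k) :
    ∃ O : S.left.Opens, (O : Set S.left).Nonempty ∧
      ((∀ s : ComplexPoints S, s.pt ∈ (O : Set S.left) →
          complexBetti.map (fiberι f s) k A ∈
            classesSupportedOn (fiberOver f s) ((fiberι f s).left.base ⁻¹' 𝒟) k) ∨
        (∀ s : ComplexPoints S, s.pt ∈ (O : Set S.left) →
          complexBetti.map (fiberι f s) k A ∉
            classesSupportedOn (fiberOver f s) ((fiberι f s).left.base ⁻¹' 𝒟) k)) := by
  haveI : LocallyOfFiniteType S.hom := hS.locallyOfFiniteType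
  haveI : IsSeparated S.hom := hS.isVarietyPair_ofScheme.isSeparated
  haveI : QuasiCompact S.hom := hS.isVarietyPair_ofScheme.quasiCompact
  haveI : CompactSpace S.left := QuasiCompact.compactSpace_of_compactSpace S.hom
  haveI := hf.smoothOfRelativeDimension
  haveI := hf.isProper
  haveI : IsSeparated 𝒳.hom := by rw [← Over.w f]; infer_instance
  have h𝒵 : IsClosed ((fst 𝒳 S).left.base ⁻¹' 𝒟) := h𝒟.preimage (fst 𝒳 S).left.base.hom.continuous
  have hY : IsIrreducible (Set.univ : Set S.left) := IrreducibleSpace.isIrreducible_univ _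
  obtain ⟨O, hO, htriv⟩ := complTrivialisation_generic f (𝟙 S) (n := n) _ h𝒵 isClosed_univ hY
  refine ⟨O, by obtain ⟨q, -, hq⟩ := hO; exact ⟨q, hq⟩, ?_⟩
  rcases dichotomy_of_complTrivialisation f (𝟙 S) _ k A isClosed_univ hY O hO (htriv O le_rfl) with h | h
  · refine Or.inl fun s hs => ?_
    have h' := h s ⟨Set.mem_univ _, hs⟩
    rw [supportLocus_eq_preimage f 𝒟 s, AlgPoints.map_id_apply] at h'
    exact h'
  · refine Or.inr fun s hs hgood => h s ⟨Set.mem_univ _, hs⟩ ?_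
    rw [supportLocus_eq_preimage f 𝒟 s, AlgPoints.map_id_apply]
    exact hgood

/-- **STUB S1 of line `support-transport` over a SMOOTH base — supports of a flat class specialise.** For a
smooth projective family `f : 𝒳 ⟶ S` of relative dimension `n` over a smooth, irreducible, quasi-projective
base with quasi-projective total space, a Zariski-closed `𝒟 ⊆ 𝒳` and a continuous section `σ` of
`FiberClass f k → S(ℂ)`: if `σ(s)` is supported on the slice `𝒟_s` for every complex point `s` of a non-empty
Zariski-open `U ⊆ S`, then it is so for EVERY complex point `s`. Registered signature of
`stub_supportLocus_specialisation` with `Smooth S.hom` added (and `IsSupportedOnSlice` unfolded): `σ` is the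
global section of one class `A` (Deligne 1968 + identity principle), whose support locus is stable under
Zariski closure, and `Ū = S`. [cite: CharlesSchnell2014Notes, Prop. 11.3.11 (proof)]
[cite: VoisinHodgeII2003, Thm. 4.18 and Lemma 4.17] [cite: SGA1, Exp. XII Prop. 2.2] -/
theorem supportLocus_specialisation_of_smooth :
    ∀ ⦃𝒳 S : SchemeOver ℂ⦄ (f : 𝒳 ⟶ S) (n k : ℕ), IsSmoothProjectiveFamily f n →
      IrreducibleSpace S.left → IsQuasiProjectiveOver S → IsQuasiProjectiveOver 𝒳 →
      AlgebraicGeometry.Smooth S.hom →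
      ∀ (𝒟 : Set 𝒳.left), IsClosed 𝒟 →
      ∀ (σ : ComplexPoints S → FiberClass f k), Continuous σ → (∀ s, (σ s).pt = s) →
      ∀ (U : Set S.left), IsOpen U → U.Nonempty →
        (∀ s : ComplexPoints S, s.pt ∈ U →
          (σ s).cls ∈ classesSupportedOn (fiberOver f (σ s).pt) ((fiberι f (σ s).pt).left.base ⁻¹' 𝒟) k) →
        ∀ s : ComplexPoints S,
          (σ s).cls ∈ classesSupportedOn (fiberOver f (σ s).pt) ((fiberι f (σ s).pt).left.base ⁻¹' 𝒟) k := by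
  intro 𝒳 S f n k hf hirr hS h𝒳 hSsm 𝒟 h𝒟 σ hσ hpt U hU hUne hgood s
  haveI := hirr
  haveI := hSsm
  haveI : LocallyOfFiniteType S.hom := hS.locallyOfFiniteType
  haveI : ConnectedSpace (ComplexPoints S) := connectedSpace_complexPoints_of_irreducibleSpace S
  haveI : IsLocallyNoetherian S.left := LocallyOfFiniteType.isLocallyNoetherian S.hom
  -- `σ` is the global section of one class `A`
  obtain ⟨A, hA⟩ := exists_forall_eq_globalSection_of_isQuasiProjectiveOver f hf h𝒳 hS hσ hpt s
  -- translate the hypothesis and the goal to `A`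
  have hgoodA : ∀ t : ComplexPoints S, t.pt ∈ U →
      complexBetti.map (fiberι f t) k A ∈ classesSupportedOn (fiberOver f t) ((fiberι f t).left.base ⁻¹' 𝒟) k :=
    fun t ht => by
      have h := hgood t ht
      rw [hA t] at h
      exact h
  rw [hA s]
  change complexBetti.map (fiberι f s) k A ∈ classesSupportedOn (fiberOver f s) ((fiberι f s).left.base ⁻¹' 𝒟) k
  -- Zariski closure of the non-empty open `U` is everything
  have hcl : closure U = Set.univ := (hU.dense hUne).closure_eq
  exact map_fiberι_mem_classesSupportedOn_of_pt_mem_closure hf hS hSsm h𝒟 k A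
    (Literature.NumberTheory.Transcendental.isLocallyConstructible_of_isOpen hU) hgoodA s
    (by rw [hcl]; exact Set.mem_univ _)

/-- **STUB S2 of line `support-transport` over a SMOOTH base — generic transport of supports.** In the
situation of S1 there is a non-empty Zariski-open `U ⊆ S` over which being supported on the slices of `𝒟`
is ALL-OR-NOTHING for the flat class `σ`: if `σ(s₂)` is supported on `𝒟_{s₂}` for one complex point `s₂` of
`U` then `σ(s)` is supported on `𝒟_s` for every complex point `s` of `U`. Registered signature of
`stub_supportLocus_genericTransport` with `Smooth S.hom` added (and `IsSupportedOnSlice` unfolded): `σ` is the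
global section of one class `A`, and the support locus of a global class satisfies the generic dichotomy
(`exists_opens_supportLocus_dichotomy`). [cite: CharlesSchnell2014Notes, Prop. 11.3.11 (proof)]
[cite: Verdier1976, Cor. (5.1)] [cite: VoisinHodgeII2003, Thm. 4.18 and Lemma 4.17] -/
theorem supportLocus_genericTransport_of_smooth :
    ∀ ⦃𝒳 S : SchemeOver ℂ⦄ (f : 𝒳 ⟶ S) (n k : ℕ), IsSmoothProjectiveFamily f n →
      IrreducibleSpace S.left → IsQuasiProjectiveOver S → IsQuasiProjectiveOver 𝒳 →
      AlgebraicGeometry.Smooth S.hom →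
      ∀ (𝒟 : Set 𝒳.left), IsClosed 𝒟 →
      ∀ (σ : ComplexPoints S → FiberClass f k), Continuous σ → (∀ s, (σ s).pt = s) →
      ∃ U : Set S.left, IsOpen U ∧ U.Nonempty ∧
        ((∃ s₂ : ComplexPoints S, s₂.pt ∈ U ∧
            (σ s₂).cls ∈ classesSupportedOn (fiberOver f (σ s₂).pt) ((fiberι f (σ s₂).pt).left.base ⁻¹' 𝒟) k) →
          ∀ s : ComplexPoints S, s.pt ∈ U →
            (σ s).cls ∈ classesSupportedOn (fiberOver f (σ s).pt) ((fiberι f (σ s).pt).left.base ⁻¹' 𝒟) k) := by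
  intro 𝒳 S f n k hf hirr hS h𝒳 hSsm 𝒟 h𝒟 σ hσ hpt
  haveI := hirr
  haveI := hSsm
  haveI : LocallyOfFiniteType S.hom := hS.locallyOfFiniteType
  haveI : ConnectedSpace (ComplexPoints S) := connectedSpace_complexPoints_of_irreducibleSpace S
  -- no complex points: any non-empty open will do
  rcases isEmpty_or_nonempty (ComplexPoints S) with hemp | ⟨⟨s₀⟩⟩
  · refine ⟨Set.univ, isOpen_univ, Set.univ_nonempty, ?_⟩
    rintro ⟨s₂, -, -⟩
    exact (IsEmpty.false s₂).elim
  -- `σ` is the global section of one class `A`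
  obtain ⟨A, hA⟩ := exists_forall_eq_globalSection_of_isQuasiProjectiveOver f hf h𝒳 hS hσ hpt s₀
  obtain ⟨O, hOne, hdich⟩ := exists_opens_supportLocus_dichotomy hf hS h𝒟 k A
  refine ⟨(O : Set S.left), O.isOpen, hOne, ?_⟩
  rintro ⟨s₂, hs₂O, hs₂⟩ s hs
  rw [hA s₂] at hs₂
  change complexBetti.map (fiberι f s₂) k A ∈
    classesSupportedOn (fiberOver f s₂) ((fiberι f s₂).left.base ⁻¹' 𝒟) k at hs₂
  rw [hA s]
  change complexBetti.map (fiberι f s) k A ∈ classesSupportedOn (fiberOver f s) ((fiberι f s).left.base ⁻¹' 𝒟) k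
  rcases hdich with h | h
  · exact h s hs
  · exact absurd hs₂ (h s₂ hs₂O)

end SupportLocus

end Summit.HodgeConjecture.HodgeConjecture.Theorems

end
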